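import Summits.BirchSwinnertonDyer.BirchSwinnertonDyer.Theorems.KatoDescentTamePotSupersingularTameUpperHeegnerRoadNodes
import HarnessLib

/-!
# Route `KatoDescentTamePotSupersingular` (rung K8, sub-rung B4 (t′), cell `bsd-potss`): the U₀-ns node's
# BODY, ROUTE-FREE — CM rows (Burungale–Flach), the surjective-mod-`p` rows (void), the fine-Selmer port of
# Kato's Tamagawa-exact bound, and the composition with the re-homed Heegner road: Coates–Sujatha's (A) is
# load-bearing on the NON-CM ♯ rows only (sequel of `…TameUpperHeegnerRoadNodes`; imports NO `Theses.*` file;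
# TARGET R100a; a `--supports … --as helper` file; seat `bsd-potss-k8t-c4` g3; nothing booked)

Second half of the R100a re-homing (see the module docstring of
`KatoDescentTamePotSupersingularTameUpperHeegnerRoadNodes`): VERBATIM route-free re-homings of g0's
`missingUpperBoundAt_of_hasCM_rankZero` (`…TameUpperNonsurjTowerReduction`), `stub_nonsurj_surjMod3Tame_holds`
(`…TameThree`, here `upper_three_of_surjModThree_of_not_towerSurj`), `padicValNat_shaOrder_le_of_katoFineSelmer_rankZero`
and `missingUpperBoundAt_tame_of_irreducible_of_fineSelmerDual_fg` (`…TameUpperNonsurjTowerFineSelmer`) as PRIVATE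
lemmas (the public originals stay in their route-importing files; the gate's dedup rule forbids public verbatim
restatements), in the sub-namespace `…Theorems.TameUpperHeegnerRoad`, and the one PUBLIC theorem
**`upperNonsurjTower_of_lower_of_rankOne_of_fineSelmerSharp`**: hypotheses = the BODIES of items 19981 (L₀),
19984 (`TameRankOne`), 19191 (`KatoTamagawaExactInputs`), 19387 (`PublishedInputsFineSelmerCM`), the four
Heegner-road facts (planned `PublishedInputsHeegner` alias children) + `exists_isNewformOf` (shared 19382),
and the ♯-form of Coates–Sujatha's (A) (the planned restatement of crux 19413); conclusion = the BODY of
`TameUpperNonsurjTower` (item 19202). After the ♯ re-cut the route's `closes` imports this module and derives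
`h₄a` by `exact TameUpperHeegnerRoad.upperNonsurjTower_of_lower_of_rankOne_of_fineSelmerSharp hGZ hKo hMN hnf
hBFH hK hF h₂ hR hCS♯` (the route decls unfold to these bodies definitionally; certified in the companion
route-importing check file of this seat). CONDITIONAL (displayed hypotheses); nothing asserted; NO item closed;
BSD is not proved by any of this.

References: [Kato2004Asterisque] Thm. 12.5 (3), Thm. 14.5 (3), 14.14, Prop. 14.16 (2); [Lim2017FineSelmer] §3;
[CoatesSujatha2005] Conj. A; [BurungaleFlach2024] Thm. 1.1, Cor. 2; [SerreAbelianLadic1968] IV-23 Lemma 3;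
[Wuthrich2014] Lemma 20; [MatarNekovar2019] Thm. 0.3, §0.11; [GreenbergLNM1716] Prop. 4.13; [Miller2011LMS] Def. 1.1.
-/

set_option autoImplicit false
-- the Theorems directory repeats the summit name (sibling precedent `KatoDescentPotSupersingularAssembly.lean`)
set_option linter.dupNamespace false

noncomputable section

open scoped Classical NumberField

namespace Summit.BirchSwinnertonDyer.BirchSwinnertonDyer.Theorems.TameUpperHeegnerRoad

open WeierstrassCurve IsDedekindDomain IsDedekindDomain.HeightOneSpectrum NumberField
  Rat.HeightOneSpectrum Literature.NumberTheory.EllipticCurves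
  Literature.NumberTheory.EllipticCurves.ModularForms
  Literature.NumberTheory.DiophantineGeometry
  Literature.NumberTheory.EllipticCurves.Rank1Residual
  Literature.NumberTheory.EllipticCurves.Rank1Residual.Typed
  Literature.NumberTheory.Automorphic Literature.NumberTheory.EllipticCurves.KrizLi2019
  Literature.NumberTheory.QuadraticFields
  Summit.BirchSwinnertonDyer.Rank1Residual
  Summit.BirchSwinnertonDyer.Rank1Residual.Additive
  Summit.BirchSwinnertonDyer.BirchSwinnertonDyer.Theorems

/-! ### §1 CM rows, Serre's lifting lemma, the tame-`3` tower, and the fine-Selmer port (re-homed from g0's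
`…TameUpperNonsurjTowerReduction` / `…TameThree` / `…FineSelmer`, route-free statements) -/

/-- **CM rows of analytic rank `0` have the upper half at EVERY prime** (granted the CM triple
`bsdTriple_of_hasCM_of_L_one_ne_zero` — Rubin 1991 / Burungale–Flach 2024 Cor. 2 —, modularity and
GZK for the finiteness of `Ш`): row C8 of the partition (`bsdp_cm_rankZero`) gives `BSD(E,p)`,
hence `MissingPPartAt W p`, hence its upper half. No reduction hypothesis at `p`.
[cite: BurungaleFlach2024, Thm. 1.1 and Cor. 2 (p. 4)] [cite: Miller2011LMS, §1 and Def. 1.1] -/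
private theorem missingUpperBoundAt_of_hasCM_rankZero (hCM : bsdTriple_of_hasCM_of_L_one_ne_zero)
    (hmod : hasEntireLFunction_rat) (hGZK : rank_eq_analyticRank_of_analyticRank_le_one)
    (W : WeierstrassCurve ℚ) [W.IsElliptic] [W.IsGloballyMinimal] (p : ℕ) [Fact p.Prime]
    (hr : W.analyticRank = 0) (hcm : W.HasCM) : MissingUpperBoundAt W p := by
  haveI : Finite W.sha := (hGZK W (by omega)).2
  exact (lower_and_upper_of_missingPPartAt W p
    (missingPPartAt_of_bsdp W p (bsdp_cm_rankZero hCM hmod hcm hr))).2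

/-- An odd prime other than `3` is at least `5`. [folklore] -/
private theorem five_le_of_prime_of_ne_two_of_ne_three {p : ℕ} (hp : p.Prime) (h2 : p ≠ 2)
    (h3 : p ≠ 3) : 5 ≤ p := by
  rcases Nat.lt_or_ge p 5 with h | h
  · have h2le := hp.two_le
    interval_cases p
    · exact absurd rfl h2
    · exact absurd rfl h3
    · exact absurd hp (by decide)
  · exact h

/-- **Re-homing of g0's `stub_nonsurj_surjMod3Tame_holds` (stub (a) of item 19202), PROVED**
— vacuously: on the (t′) cell at `3` (Kodaira `III`/`III*`) with `E[3]` irreducible, surj(3) gives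
the whole `3`-adic tower (`Additive.ClassX4.towerSurj_three_of_surj_of_subTprime`), contradicting
the row's hypothesis that the tower is not onto. Statement binder-for-binder the registered one.
[cite: Wuthrich2014, Lemma 20 (p. 399)] [cite: SilvermanATAEC1994, IV.9.4 and Table 4.1 (PDF pp. 344–346, 365)] -/
private theorem upper_three_of_surjModThree_of_not_towerSurj :
    ∀ (W : WeierstrassCurve ℚ) [W.IsElliptic] [W.IsGloballyMinimal] [Fact (3 : ℕ).Prime],
      W.analyticRank = 0 → Addv W 3 → SubTprime W 3 → W.HasIrreducibleModPGaloisRep 3 →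
      W.HasSurjectiveModNGaloisRep 3 → ¬ (∀ n : ℕ, W.HasSurjectiveModNGaloisRep (3 ^ n : ℕ)) →
        MissingUpperBoundAt W 3 := by
  intro W _ _ _ _ hadd hT hI hsurj hns
  exact absurd (ClassX4.towerSurj_three_of_surj_of_subTprime ⟨by decide, hadd, hI⟩ hT hsurj) hns

/-- **Rank-`0` upper bound with the torsion term from the fine-Selmer reading**: at an odd additive
potentially good `p` with `E[p]` irreducible and `Y(E/ℚ^cyc)` finitely generated over `ℤ_p` (`hA`),
`#Ш_an = q` and `ord_p #Ш ≤ ord_p q − 2 ord_p #E(ℚ)_tors` — NO Tamagawa term (the reading bounds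
`ord_p #Ш + v_p(∏c_ℓ)` by `ord_p(L/Ω)` and `#Ш_an = (L/Ω)·#tors²/∏c_ℓ`). Bookkeeping twin of
`Additive.padicValNat_shaOrder_le_of_katoTam_rankZero`.
[cite: Kato2004Asterisque, Thm. 14.5 (3) (p. 236), Thm. 12.5 (3) (p. 222), 14.14 (p. 243), Prop. 14.16 (2) (p. 244), §14.8 (p. 238)]
[cite: Lim2017FineSelmer, §3] [cite: GreenbergLNM1716, §4 Prop. 4.13; §3 Lemma 3.3] [cite: Miller2011LMS, Def. 1.1] -/
private theorem padicValNat_shaOrder_le_of_katoFineSelmer_rankZero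
    (hKatoA :
      Kato2004.rankZero_padicValNat_sha_add_padicValNat_tamagawa_le_of_additive_potGood_of_irreducible_of_fineSelmerDual_fg)
    (hGZK : rank_eq_analyticRank_of_analyticRank_le_one) (hmod : hasEntireLFunction_rat)
    (W : WeierstrassCurve ℚ) [W.IsElliptic] [W.IsGloballyMinimal] (p : ℕ) [Fact p.Prime]
    (hp : p ≠ 2) (hgood : ¬ W.HasGoodReductionAtPrime p) (hmult : ¬ W.HasMultiplicativeReductionAtPrime p)
    (hpot : 0 ≤ padicValRat p W.j) (hirr : W.HasIrreducibleModPGaloisRep p)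
    (hA : ∀ (κ : ZpExtension ℚ p), κ.IsCyclotomic →
      ∃ (γ : Field.absoluteGaloisGroup ℚ) (D : W.FineSelmerDualData κ γ),
        Module.Finite ℤ_[p] (RestrictScalars ℤ_[p] (IwasawaAlgebra p) D.X))
    (hr : W.analyticRank = 0) :
    ∃ q : ℚ, shaAn W = (q : ℂ) ∧
      (padicValNat p W.shaOrder : ℤ) ≤ padicValRat p q - 2 * padicValNat p W.torsionOrder := by
  have hL : W.entireLFunction 1 ≠ 0 := (W.analyticRank_eq_zero_iff_holds (hmod W)).mp hr
  obtain ⟨hmw, hfin⟩ := hGZK W (by rw [hr]; exact zero_le_one)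
  haveI : Finite W.sha := hfin
  have hmw0 : W.mordellWeilRank = 0 := by rw [hmw, hr]
  obtain ⟨q₀, hq₀, hle⟩ := hKatoA W p hp hgood hmult hpot hirr hA hL hfin
  have hΩpos : 0 < W.realPeriodRat := W.realPeriodRat_pos_holds
  have hΩ : (W.realPeriodRat : ℂ) ≠ 0 := by exact_mod_cast hΩpos.ne'
  have hc0 : 0 < W.tamagawaProduct := W.tamagawaProduct_pos_holds
  have ht0 : 0 < W.torsionOrder := W.torsionOrder_pos_holds
  have hq₀0 : q₀ ≠ 0 := by
    rintro rfl
    rw [Rat.cast_zero, div_eq_zero_iff] at hq₀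
    exact hq₀.elim hL hΩ
  refine ⟨q₀ * (W.torsionOrder : ℚ) ^ 2 / (W.tamagawaProduct : ℚ), ?_, ?_⟩
  · have hLq : W.entireLFunction 1 = (q₀ : ℂ) * (W.realPeriodRat : ℂ) := by
      rw [← hq₀, div_mul_cancel₀ _ hΩ]
    rw [shaAn_def, W.leadingLCoeff_eq_of_analyticRank_eq_zero hr,
      W.regulator_eq_one_of_rank_zero hmw0, hLq]
    push_cast
    field_simp
  · have ht : (W.torsionOrder : ℚ) ≠ 0 := by exact_mod_cast ht0.ne'
    have hcq : (W.tamagawaProduct : ℚ) ≠ 0 := by exact_mod_cast hc0.ne'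
    have hsha : padicValNat p (Nat.card (AddCommGroup.primaryComponent W.sha p)) =
        padicValNat p W.shaOrder := by
      unfold WeierstrassCurve.shaOrder
      exact padicValNat_card_addPrimaryComponent p
    have hv : padicValRat p (q₀ * (W.torsionOrder : ℚ) ^ 2 / (W.tamagawaProduct : ℚ)) =
        padicValRat p q₀ + 2 * (padicValNat p W.torsionOrder : ℤ) -
          (padicValNat p W.tamagawaProduct : ℤ) := by
      rw [padicValRat.div (mul_ne_zero hq₀0 (pow_ne_zero 2 ht)) hcq,
        padicValRat.mul hq₀0 (pow_ne_zero 2 ht), pow_two, padicValRat.mul ht ht,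
        padicValRat.of_nat, padicValRat.of_nat]
      ring
    rw [hv, ← hsha]
    linarith

/-- **The upper half on an irreducible rank-`0` (t′) row from the finite generation of `Y(E/ℚ^cyc)`
over `ℤ_p`** (any image size; `ord_p j ≥ 0` from `ClassO5`; torsion term killed by irreducibility):
granted the fine-Selmer reading, GZK and modularity, `hA` at `(E,p)` gives `MissingUpperBoundAt W p`.
Twin of `X4RankZero.missingUpperBoundAt_of_katoTam` with tower surjectivity replaced by `hA`.
[cite: Kato2004Asterisque, Thm. 14.5 (3) (p. 236), Thm. 12.5 (3) (p. 222), 14.14 (p. 243)]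
[cite: Lim2017FineSelmer, §3] [cite: Miller2011LMS, Def. 1.1] -/
private theorem missingUpperBoundAt_tame_of_irreducible_of_fineSelmerDual_fg
    (hKatoA :
      Kato2004.rankZero_padicValNat_sha_add_padicValNat_tamagawa_le_of_additive_potGood_of_irreducible_of_fineSelmerDual_fg)
    (hGZK : rank_eq_analyticRank_of_analyticRank_le_one) (hmod : hasEntireLFunction_rat)
    (W : WeierstrassCurve ℚ) [W.IsElliptic] [W.IsGloballyMinimal] (p : ℕ) [Fact p.Prime]
    (hr : W.analyticRank = 0) (hp2 : p ≠ 2) (hadd : Addv W p) (hT : SubTprime W p)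
    (hirr : W.HasIrreducibleModPGaloisRep p)
    (hA : ∀ (κ : ZpExtension ℚ p), κ.IsCyclotomic →
      ∃ (γ : Field.absoluteGaloisGroup ℚ) (D : W.FineSelmerDualData κ γ),
        Module.Finite ℤ_[p] (RestrictScalars ℤ_[p] (IwasawaAlgebra p) D.X)) :
    MissingUpperBoundAt W p := by
  have hO5 : ClassO5 W p := ⟨hp2, hadd, Or.inr hT⟩
  obtain ⟨q, hq, hle⟩ :=
    padicValNat_shaOrder_le_of_katoFineSelmer_rankZero hKatoA hGZK hmod W p hp2 hadd.1 hadd.2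
      hO5.padicValRat_j_nonneg hirr hA hr
  refine ⟨q, hq, ?_⟩
  rw [padicValNat_torsionOrder_eq_zero_of_irreducible W p hirr] at hle
  simpa using hle

/-! ### §2 The U₀-ns node's BODY from L₀, the rank-one rows, published facts and (A) on the non-CM ♯ rows -/

/-- **The BODY of the U₀-ns node `TameUpperNonsurjTower` (item 19202) from the BODY of L₀ (19981), the
BODY of the residual `TameRankOne` (19984), the BODIES of the cite-level items `KatoTamagawaExactInputs`
(19191: A161″ ∧ GZK ∧ modularity; A161″ unused) and `PublishedInputsFineSelmerCM` (19387: Kato 14.5 (3)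
in the fine-Selmer reading ∧ the Burungale–Flach CM triple), the Heegner-road published facts
(Gross–Zagier, Kolyvagin, Matar–Nekovář's irreducible Kolyvagin bound — schemata over `(N, W, K)` —,
newforms, Bump–Friedberg–Hoffstein), and COATES–SUJATHA'S (A) ON THE NON-CM ♯ ROWS WITH `ρ̄_{E,p}`
NOT ONTO ONLY** (the planned restatement of crux 19413: `p ∣ ∏c_ℓ(E)` or no datum at level `N_E`
with `p ∤ c`). Rows: CM → Burungale–Flach (`missingUpperBoundAt_of_hasCM_rankZero`); `ρ̄` onto →
void (`p = 3`: tame tower, `upper_three_of_surjModThree_of_not_towerSurj`; `p ≥ 5`: Serre); non-CM,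
`ρ̄` not onto, ♭ → the Heegner road (`missingUpperBoundAt_tameIrr_rankZero_of_lower_of_rankOne`); ♯ →
the fine-Selmer port + (A) (`missingUpperBoundAt_tame_of_irreducible_of_fineSelmerDual_fg`). Re-homing,
route-free, of p429560's `tameUpperNonsurjTower_of_tameLower_of_tameRankOne_of_fineSelmerSharp`: the
term `closes` calls after the ♯ re-cut. Conditional; nothing asserted; NO item is closed.
[cite: Kato2004Asterisque, Thm. 14.5 (3) (p. 236), Prop. 14.16 (2) (p. 244)]
[cite: CoatesSujatha2005, Conjecture A] [cite: MatarNekovar2019, Thm. 0.3 (p. 456), §0.11 (p. 457)]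
[cite: BurungaleFlach2024, Thm. 1.1 and Cor. 2 (p. 4)] [cite: SerreAbelianLadic1968, Ch. IV §3.4 Lemma 3 (IV-23)] -/
theorem upperNonsurjTower_of_lower_of_rankOne_of_fineSelmerSharp
    (hGZ : ∀ (N : ℕ) [NeZero N] (W : WeierstrassCurve ℚ) (K : Type) [Field K] [NumberField K],
      gross_zagier N W K)
    (hKo : ∀ (N : ℕ) [NeZero N] (W : WeierstrassCurve ℚ) (K : Type) [Field K] [NumberField K],
      kolyvagin N W K)
    (hMN : ∀ (N : ℕ) [NeZero N] (W : WeierstrassCurve ℚ) (K : Type) [Field K] [NumberField K],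
      MatarNekovar2019.thm03_padicValNat_card_sha_le_of_irreducible N W K)
    (hnf : exists_isNewformOf) (hBFH : bumpFriedbergHoffstein_exists_heegnerField_split_twist_simpleZero)
    (hK : Kato2004.rankZero_padicValNat_sha_add_padicValNat_tamagawa_le_of_additive_potGood_of_imageContainsSL2 ∧
      rank_eq_analyticRank_of_analyticRank_le_one ∧ WeierstrassCurve.hasEntireLFunction_rat)
    (hF : Kato2004.rankZero_padicValNat_sha_add_padicValNat_tamagawa_le_of_additive_potGood_of_irreducible_of_fineSelmerDual_fg ∧
      bsdTriple_of_hasCM_of_L_one_ne_zero)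
    (h₂ : ∀ (W : WeierstrassCurve ℚ) [W.IsElliptic] [W.IsGloballyMinimal] (p : ℕ) [Fact p.Prime],
      W.analyticRank = 0 → p ≠ 2 → Addv W p → SubTprime W p → MissingLowerBoundAt W p)
    (hR : ∀ (W : WeierstrassCurve ℚ) [W.IsElliptic] [W.IsGloballyMinimal] (p : ℕ) [Fact p.Prime],
      W.analyticRank = 1 → p ≠ 2 → Addv W p → SubTprime W p → MissingPPartAt W p)
    (hCS : ∀ (W : WeierstrassCurve ℚ) [W.IsElliptic] [W.IsGloballyMinimal] (p : ℕ) [Fact p.Prime],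
      W.analyticRank = 0 → p ≠ 2 → Addv W p → SubTprime W p → ¬ W.HasCM →
      W.HasIrreducibleModPGaloisRep p → ¬ W.HasSurjectiveModNGaloisRep p →
      (p ∣ W.tamagawaProduct ∨ ∀ [NeZero (W.conductorNorm ℤ)]
        (D : ModularParametrizationData W (W.conductorNorm ℤ)), (p : ℤ) ∣ D.c) →
      ∀ (κ : ZpExtension ℚ p), κ.IsCyclotomic →
        ∃ (γ : Field.absoluteGaloisGroup ℚ) (D : W.FineSelmerDualData κ γ),
          Module.Finite ℤ_[p] (RestrictScalars ℤ_[p] (IwasawaAlgebra p) D.X)) :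
    ∀ (W : WeierstrassCurve ℚ) [W.IsElliptic] [W.IsGloballyMinimal] (p : ℕ) [Fact p.Prime],
      W.analyticRank = 0 → p ≠ 2 → Addv W p → SubTprime W p → W.HasIrreducibleModPGaloisRep p →
      ¬ (∀ n : ℕ, W.HasSurjectiveModNGaloisRep (p ^ n : ℕ)) → MissingUpperBoundAt W p := by
  intro W _ _ p _ hr hp2 hadd hT hI hns
  haveI : NeZero (W.conductorNorm ℤ) := ⟨(conductorNorm_pos_holds W).ne'⟩
  -- CM rows: Burungale–Flach
  by_cases hcm : W.HasCM
  · exact missingUpperBoundAt_of_hasCM_rankZero hF.2 hK.2.2 hK.2.1 W p hr hcm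
  -- `ρ̄_{E,p}` onto is void on these rows (the tower would be onto)
  by_cases hsp : W.HasSurjectiveModNGaloisRep p
  · by_cases h3 : p = 3
    · subst h3
      exact upper_three_of_surjModThree_of_not_towerSurj W hr hadd hT hI hsp hns
    · exact absurd (serre_hasSurjectiveModNGaloisRep_pow_holds W p
        (five_le_of_prime_of_ne_two_of_ne_three Fact.out hp2 h3) hsp) hns
  -- ♭ rows: the Heegner road; ♯ rows: the fine-Selmer port + (A)
  by_cases hclean : ¬ p ∣ W.tamagawaProduct ∧
      ∃ D : ModularParametrizationData W (W.conductorNorm ℤ), ¬ (p : ℤ) ∣ D.c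
  · obtain ⟨htam, D, hc⟩ := hclean
    exact missingUpperBoundAt_tameIrr_rankZero_of_lower_of_rankOne hGZ hKo hMN hK.2.1 hK.2.2 hnf hBFH
      h₂ hR W p hr hp2 hadd hT hI D hc htam
  · have hsharp : p ∣ W.tamagawaProduct ∨ ∀ [NeZero (W.conductorNorm ℤ)]
        (D : ModularParametrizationData W (W.conductorNorm ℤ)), (p : ℤ) ∣ D.c := by
      by_cases htam : p ∣ W.tamagawaProduct
      · exact Or.inl htam
      · refine Or.inr fun D ↦ ?_
        by_contra hcD
        exact hclean ⟨htam, D, hcD⟩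
    exact missingUpperBoundAt_tame_of_irreducible_of_fineSelmerDual_fg hF.1 hK.2.1 hK.2.2 W p hr hp2
      hadd hT hI (hCS W p hr hp2 hadd hT hcm hI hsp hsharp)

end Summit.BirchSwinnertonDyer.BirchSwinnertonDyer.Theorems.TameUpperHeegnerRoad

end
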